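import Summits.QuantumFields.YangMills.Theorems.BalabanUVNodesN16Thm4ZdOfLeaf
import Literature.MathematicalPhysics.QuantumFieldTheory.Balaban1983to89.B8LeafModelZdHP2Per
import Literature.MathematicalPhysics.QuantumFieldTheory.Balaban1983to89.B8IdxB8SubDPerUnivFam
import Literature.MathematicalPhysics.QuantumFieldTheory.Balaban1983to89.Node00.CarriersB8SubBP2DPerKappa

/-!
# Route «BalabanUVNodes», crux K3⁸ `SpineGivenEndpointR13SepCoPHV` (stmt-QuantumFields-27366), node N16 = NE3 — THE MODEL FACE OF THE
# N05-RECORD-CURRENCY SEAM, THEOREM-4 HALF: the Theorem-4 clause of node N05's PERIODIC δ₂-model of record `B8LeafModelZdHP2Per.zdGF3HP₂Per`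
# AT AN ALL-TORUS MEMBER (`Ω_j = ℤᵈ` for `j ≤ k`, diagonal towers) ⟹ node N16's entry shape
# `B8Thm4TorusAt.Thm4TorusAt L k P η c₁′ (unitaryUnits 𝔸) Reg (Restr129 L k (torusLam k)) Concl_T4` DIRECTLY AT THE PERIOD `P`

Cell `pub-ymgap`, seat `pub-ymgap-dag-n16-e` (R134 acceleration seat (a), strategy s2 = knit node N16 AT THE RECORD; HUMAN RULING D-0062; chair R424 venue),
generation 23.  `--kind proof --supports stmt-QuantumFields-27366 --as helper` (count-neutral; proves NO registered stub).  `bears_on: R4∕N16 · edge N05 → N16`.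

WHY (gap (g3) of this seat's LOCATED note «N16 ∕ N05 record-currency seam», pub-ymgap bus 2026-08-28, plan g87 word «(B): type the κ-reader on the booked object»;
this file is the OBJECT-INDEPENDENT model face underneath it).  Node N16 reads node N05's Theorem 4 through `B8Thm4TorusAt.Thm4TorusAt` — n16-c's ℤᵈ junction
`…N16Thm4ZdOfLeaf.thm4TorusAt_zero_of_leaf_member` (Theorem-4 clause of n05-a's ORIGINAL member `zdGF3` at the all-torus member ⟹ `Thm4TorusAt … 0 …`) followed by the
periodicity principle `…N16Thm4TorusOfZd.thm4TorusAt_print_of_zd` (period `0` ⟹ period `N·Lᵏ`).  Node N05's witness slot of record is keyed on the `P`-PERIODIC sub-model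
`zdGF3HP₂Per 𝔸 L β len i P` of the REPAIRED member `zdGF3HP₂` (`Node00.CarriersB8SubBP2DPerKappa`, family `famB8OfRecordSubBP₂DPer`), over the print-class periodic cut
`IdxB8SubDPerκ`, which CONTAINS the truncated all-torus tower (`B8IdxB8SubDPerUnivFam.exists_idxB8SubDPerκ_univFam`, this seat).  THIS FILE is the periodic analogue of
n16-c's junction for that model: the Theorem-4 clause of `zdGF3HP₂Per` at a member `i` with `Ω_j = ℤᵈ (j ≤ k)` and towers `Λs m l = torusLam m l (l ≤ m ≤ k)` — exactly what
rigidity gives at the `univFam k` member (`IdxB8SubDPerκ.Λs_univFam`) and what node N16's pinned members satisfy — yields `Thm4TorusAt L i.k P i.η c₁′ …` with n16-c's `Concl_T4`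
(plus the periodicity of the exponent field), WITHOUT the periodicity principle: the periodic model's «exactly one periodic u» IS the torus statement.
The four letters `zdGF3HP₂` re-reads ((1.35)∕(1.66) on `EndBlockIn`, (1.37)∕(1.42) on `towerBondsP`, (1.36) δ₂, `InR`) coincide with `zdGF3`'s at such a member on everything
Theorem 4 reads (§1: `towerBondsP L Ω (Λs k) j` is ALL level-`k` bonds at `j = k` and EMPTY below; the `EndBlockIn` guard is discharged for every bond).

WHAT THIS FILE PROVES (kernel; theorems only, 0 `def`, 0 `sorry`):
§1 `inAk_congr_le`, `inAx_congr_le`, `restr129_congr_le`, `qT_congr_le`, `isLandau138_congr_le` (the three tower-reading predicates read `Λ` only up to their truncation — so a member whose towers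
   are diagonal on `l ≤ m ≤ k` is as good as `torusLam`), `mem_towerBondsP_iff_eq_top` (print's bond class at an all-torus member), `mlogCfg_eq_logCfg_of_univ_zero`.
§2 ★★ `thm4TorusAt_of_hp2per_member` — the junction at given constants `c₁, B₁′` and any window `c₁′ ≤ c₁`, `16·B₁′·c₁′ ≤ 1`, `C₀·2c₁′ ≤ ⅓`, `4c₁′ ≤ c₂′`.
§3 ★★ `exists_thm4TorusAt_of_thm4Printed_hp2per` — from `B8.Thm4Printed B₁′ (fun a ↦ (zdGF3HP₂Per 𝔸 L β len (ι a) (p a)).toGFData)` (the `t4` conjunct of node N05's κ-slot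
   reads exactly this, `Node00.b8LeafOfRecordSubBP₂DPerκ_t4`) at any index `a` whose member is all-torus up to `k`: `∃ c₁′ > 0, Thm4TorusAt L k (p a) η c₁′ …` (window by
   n16-c's `exists_window`).
§4 ★★★ `exists_thm4TorusAt_of_b8LeafOfRecordSubBP₂DPerκ` — NODE N16's TORUS READING OF THEOREM 4 FROM NODE N05's WITNESS SLOT OF RECORD: the κ-periodic δ₂-slot
   `Node00.B8LeafOfRecordSubBP₂DPerκ θ P M₁ R lam` (ANY `(P, M₁, R)`, any residual layer `lam`, `0 ≤ lam.base.B₁′`, `θ.D ≥ 2`) gives, at every depth `k ≥ 1` with `Lᵏ ∣ P`,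
   `∃ c₁′ > 0, Thm4TorusAt θ.L k P L⁻ᵏ c₁′ (unitaryUnits θ.𝔸) Reg (Restr129 θ.L k (torusLam k)) Concl_T4` — §3 at the `univFam k` member of the κ-cut
   (`B8IdxB8SubDPerUnivFam.exists_idxB8SubDPerκ_univFam`, its towers by rigidity `IdxB8SubDPerκ.Λs_univFam`) and the slot's `t4` projection.  The first theorem in the tree in
   which node N16's entry shape reads node N05's object of record (gap (g3), Theorem-4 half; the Proposition-3 half and the print-list edition are the successor's).

HONEST FRAMING.  Bookkeeping BY NAME (a dictionary between two typed readings of the same printed theorem on the torus); no estimate; Theorem 4 at curved backgrounds is node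
N05's theorem and is NOT proved here (the clause is a HYPOTHESIS); nothing of Bałaban asserted; no stub of K3⁸ closed or claimed; N16 ∕ N05 NOT discharged; counts UNMOVED
(typed 28∕28 · discharged 5∕27 · A 5∕28).  One finite four-torus at fixed `ε`, Bałaban AS PRINTED — NOT ℝ⁴, NOT infinite volume, NOT OS, NOT a mass gap; the YM mass gap (Clay)
is NOT proved by any of this.
References: [Balaban1985RegularSpaces] T. Bałaban, CMP **99** (1985) 75–102, Thm 4 p. 88, (1.29) p. 81, (1.33)–(1.38) p. 82, (1.62) p. 87, (1.66) p. 87, p. 77 («Ω_j = T_η»).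
-/

set_option autoImplicit false

open scoped BigOperators
open NormedSpace

namespace Summit.QuantumFields.YangMills.BalabanUVNodes.N16.Thm4TorusOfHP2PerMember

open Literature.MathematicalPhysics.QuantumFieldTheory.Balaban1983to89
open B7Prop1Explicit B7Prop2Explicit
open B7Eq92Concrete (mgauge)
open B8Ineq132 (InAk)
open B8Eq184Proof (cfgExp)
open B8Eq119TwistedAxial (Restr129 InAx)
open B8Eq138LandauZd (IsLandau138 IsLandau138W logCfg QT)
open B8Eq140Level (SideTouches)
open B8Eq146AExpansion (iEta)
open B7Prop4GeneralLevels (logCovIter)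
open B8Thm4TorusAt (torusLam torusLam_self mem_torusLam_iff Cond166T Thm4TorusAt)
open B8Lemma1NonAbelian (mulCfg)
open B8LeafModelZd (ZdIdx)
open B8LeafModelZd3 (mlogCfg mlogCfg_of_sideTouches)
open B8LeafModelZd3P (EndBlockIn)
open B8LeafModelZdPer (isPeriodic_iff_shiftCfg isPeriodic_mgauge isPeriodic_inv)
open B8LeafModelZdHP2Per (zdGF3HP₂Per)
open B8TowerBondsPrinted (towerBondsP)
open B8Prop3GaugeFixedKLevel (eq_mgauge_inv_of_mgauge_eq mem_unitaryUnits_of_mgauge_eq logField_spec)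
open B8Thm4AtLandau138 (mgauge_mgauge_inv)
open B12Ineq417Flat (shiftCfg shiftCfg_apply)
open T4TermwiseTorus (IsPeriodic)
open Summit.QuantumFields.YangMills.BalabanUVNodes.N16.Thm4ZdOfLeaf (sideTouches_univ inAx_torusLam_of_le avgIter_mem_unitaryUnits_of_inAk_univ
  avgClose_of_cond166T sides_of_cond166T exists_window)

noncomputable section

variable {d : ℕ}

/-! ## §1 The tower-reading predicates read `Λ` only up to their truncation; print's bond class and the masked logarithm at an all-torus member -/

section Congr

variable {𝔸 : Type} [CStarAlgebra 𝔸]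

/-- `Ax_m(𝔅, U₀)` reads the tower only at the levels `1 ≤ j ≤ m`. [cite: Balaban1985RegularSpaces, (1.19) p.79, (1.34) p.82] -/
theorem inAx_congr_le {L m : ℕ} {Λ Λ' : ℕ → Set (Site d)} (h : ∀ j, j ≤ m → Λ j = Λ' j) (U₀ W : Site d → Fin d → 𝔸ˣ) :
    InAx L m Λ U₀ W ↔ InAx L m Λ' U₀ W := by
  unfold InAx
  refine forall_congr' fun j => forall_congr' fun _ => forall_congr' fun hj => ?_
  rw [h j hj]

/-- `𝔄_k({Ω_j}, α)` reads the domains only at the levels `j ≤ k`. [cite: Balaban1985RegularSpaces, (1.7)–(1.9) p.77] -/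
theorem inAk_congr_le {L k : ℕ} {η α : ℝ} {Ω Ω' : ℕ → Set (Site d)} (h : ∀ j, j ≤ k → Ω j = Ω' j) (V : Site d → Fin d → 𝔸ˣ) :
    InAk L k η α Ω V ↔ InAk L k η α Ω' V := by
  unfold InAk
  refine forall_congr' fun j => forall_congr' fun hj => ?_
  rw [h j hj]

/-- (1.29) reads the tower only at the levels `j ≤ k`. [cite: Balaban1985RegularSpaces, (1.29) p.81] -/
theorem restr129_congr_le {L k : ℕ} {Λ Λ' : ℕ → Set (Site d)} (h : ∀ j, j ≤ k → Λ j = Λ' j)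
    (U₀ : Site d → Fin d → 𝔸ˣ) (u : Site d → 𝔸ˣ) : Restr129 L k Λ U₀ u ↔ Restr129 L k Λ' U₀ u := by
  unfold Restr129
  refine forall_congr' fun j => forall_congr' fun hj => ?_
  rw [h j hj]

/-- `Q′(U₀)ᵀμ` on `𝔅_m` reads the tower only at the levels `j ≤ m`. [cite: Balaban1985BackgroundPropagators, (3.24) p.394; Balaban1985RegularSpaces, (1.29) p.81] -/
theorem qT_congr_le {L m : ℕ} {Λ Λ' : ℕ → Set (Site d)} (h : ∀ j, j ≤ m → Λ j = Λ' j) (U₀ : Site d → Fin d → 𝔸ˣ)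
    (μ : ℕ → Site d → 𝔸) (x : Site d) : QT L m Λ U₀ μ x = QT L m Λ' U₀ μ x := by
  unfold QT
  refine Finset.sum_congr rfl fun j hj => ?_
  rw [h j (Nat.lt_succ_iff.1 (Finset.mem_range.1 hj))]

/-- (1.38) reads the tower only at the levels `j ≤ m`. [cite: Balaban1985RegularSpaces, (1.38) p.82] -/
theorem isLandau138_congr_le {L m : ℕ} {η : ℝ} {Ω₀ : Set (Site d)} {Λ Λ' : ℕ → Set (Site d)} (h : ∀ j, j ≤ m → Λ j = Λ' j)
    (U₀ : Site d → Fin d → 𝔸ˣ) (A : Site d → Fin d → 𝔸) : IsLandau138 L m η Ω₀ Λ U₀ A ↔ IsLandau138 L m η Ω₀ Λ' U₀ A := by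
  unfold IsLandau138
  refine exists_congr fun μ => forall_congr' fun x => forall_congr' fun _ => ?_
  rw [qT_congr_le h U₀ μ x]

end Congr

section Geometry

/-- **PRINT'S BOND CLASS AT AN ALL-TORUS MEMBER**: if `Ω_j = ℤᵈ` for `j ≤ k` and the top truncation's towers are `Λ_k = ℤᵈ`, `Λ_l = ∅ (l < k)` (`torusLam k` on `l ≤ k`), then for
`j ≤ k` a level-`j` bond lies in `towerBondsP L Ω Λ j` iff `j = k` (then EVERY bond does: the inner disjunct; below `k` every disjunct asks for a site of `Λ_j = ∅`).
[cite: Balaban1985RegularSpaces, (1.31) p.82, (1.37) p.82, p.77 («we admit the case where some domains Ω_j are equal to T_η»)] -/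
theorem mem_towerBondsP_iff_eq_top {L k : ℕ} {Ω Λ : ℕ → Set (Site d)} (hΩ : ∀ j, j ≤ k → Ω j = Set.univ)
    (hΛ : ∀ l, l ≤ k → Λ l = torusLam k l) {j : ℕ} (hj : j ≤ k) (c : Site d × Fin d) : c ∈ towerBondsP L Ω Λ j ↔ j = k := by
  rw [B8TowerBondsPrinted.mem_towerBondsP_iff, hΛ j hj]
  constructor
  · rintro (⟨-, h1, -⟩ | ⟨-, (⟨j', -, -, h2⟩ | ⟨j', -, h3, -⟩)⟩)
    · exact (mem_torusLam_iff k j c.1).1 h1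
    · exact (mem_torusLam_iff k j _).1 h2
    · exact (mem_torusLam_iff k j c.1).1 h3
  · rintro rfl
    refine Or.inl ⟨fun x _ => ?_, ?_, ?_⟩
    · rw [hΩ j le_rfl]; exact Set.mem_univ x
    · rw [torusLam_self]; exact Set.mem_univ _
    · rw [torusLam_self]; exact Set.mem_univ _

variable {𝔸 : Type*} [CStarAlgebra 𝔸]

/-- **WHEN `Ω₀ = ℤᵈ` THE CANONICAL MASKED LOGARITHM IS THE LOGARITHM** (`d ≥ 2`: every bond is a side of a plaquette touching `Ω₀`; only `Ω₀` is read).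
[cite: Balaban1985RegularSpaces, (1.36) p.82, p.89 («A₀ = (1/iη) log U′»)] -/
theorem mlogCfg_eq_logCfg_of_univ_zero (hd2 : 2 ≤ d) (k : ℕ) (η : ℝ) {Ω : ℕ → Set (Site d)} (hΩ : Ω 0 = Set.univ)
    (W : Site d → Fin d → 𝔸ˣ) : mlogCfg k η Ω W = logCfg η W := by
  funext y τ
  exact mlogCfg_of_sideTouches η W (Nat.zero_le k) (by rw [hΩ]; exact sideTouches_univ hd2 y τ)

end Geometry

/-! ## §2 The junction at an all-torus member of the periodic δ₂-model, at the period `P` -/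

section Member

variable {𝔸 : Type} [CStarAlgebra 𝔸] [Nontrivial 𝔸]

/-- **★★ THE LETTER JUNCTION AT AN ALL-TORUS MEMBER OF NODE N05's PERIODIC δ₂-MODEL OF RECORD, DIRECTLY AT THE PERIOD.**  Let `d, L ≥ 2`, `P : ℕ`, and let
`i : ZdIdx d L` be all-torus on everything Theorem 4 reads: `Ω_j = ℤᵈ` for `j ≤ k` and `Λs m l = torusLam m l` for `l ≤ m ≤ k` (node N16's pinned members; the `univFam k`
member of the κ-cut by rigidity, `B8IdxB8SubDPerUnivFam.IdxB8SubDPerκ.Λs_univFam`).  If the Theorem-4 clause of the leaf holds at the member `zdGF3HP₂Per 𝔸 L β len i P`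
with constants `c₁, B₁′` — for `α₀, α₁ > 0`, `α₀ + α₁ ≤ c₁`, periodic data `U₀`, `(U₀, U′)` with `InA ∕ Reg335 ∕ InAAx ∕ avgClose166` there is exactly one PERIODIC
`u : GT` with `Restricted` and (1.37) `C137` (over `towerBondsP`), (1.38) `Landau`, (1.62) `C162 B₁′ (α₀+α₁)` for `U′^{u⁻¹}` — then for every `Reg` and every window
`c₁′ ≤ c₁`, `0 ≤ B₁′`, `16·B₁′·c₁′ ≤ 1`, `C₀·2c₁′ ≤ ⅓`, `4c₁′ ≤ c₂′`:
`Thm4TorusAt L i.k P i.η c₁′ (unitaryUnits 𝔸) Reg (Restr129 L i.k (torusLam i.k)) Concl_T4` with n16-c's `Concl_T4 α₀ α₁ U₀ U′ u := ∃ A` self-adjoint AND `P`-PERIODIC,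
`U′ = (e^{iηA})^{u}` rel. `U₀`, `‖A‖ ≤ B₁′(α₀+α₁)(Lᵏη)⁻¹`, `IsLandau138 L k η univ (torusLam k) U₀ A`, `‖logCovIter L U₀ (iηA) k c‖ < 2dLα₁` at every level-`k` bond.
Existence: the leaf's periodic `u`, `A := (iη)⁻¹ log U′^{u⁻¹}` (periodic; the masked logarithm is the logarithm, §1); uniqueness: a periodic competitor with `Concl_T4` is a
member `GT` whose `A′` is `(iη)⁻¹ log` of its gauge-fixed field (`logField_spec`), so the leaf's «exactly one» applies — NO periodicity principle needed.
[cite: Balaban1985RegularSpaces, Thm 4 p.88 («there exists exactly one gauge transformation u»), (1.29) p.81, (1.33)–(1.34) p.82, (1.37)–(1.38) p.82, (1.62) p.87, (1.66) p.87, p.77 («Ω_j ⊂ T_η … we admit Ω_j = T_η»)] -/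
theorem thm4TorusAt_of_hp2per_member (hd2 : 2 ≤ d) {L : ℕ} (hL : 2 ≤ L) {β : ℝ} {len : Site d → ℝ} (i : ZdIdx d L) (P : ℕ)
    (hΩ : ∀ j, j ≤ i.k → i.Ω j = Set.univ) (hΛs : ∀ m, m ≤ i.k → ∀ l, l ≤ m → i.Λs m l = torusLam m l)
    {c₁ c₁' B₁' : ℝ} (hc : c₁' ≤ c₁) (hB : 0 ≤ B₁') (h16 : 16 * (B₁' * c₁') ≤ 1) (hC0 : C0 d * (2 * c₁') ≤ 1 / 3)
    (hc2 : 4 * c₁' ≤ c2' d L) (Reg : (Site d → Fin d → 𝔸ˣ) → Prop)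
    (hT : ∀ α₀ α₁ : ℝ, 0 < α₀ → 0 < α₁ → α₀ + α₁ ≤ c₁ →
      ∀ (U₀ : (zdGF3HP₂Per 𝔸 L β len i P).Cfg) (Q : (zdGF3HP₂Per 𝔸 L β len i P).Pert),
        (zdGF3HP₂Per 𝔸 L β len i P).InA α₀ U₀ → (zdGF3HP₂Per 𝔸 L β len i P).Reg335 α₀ U₀ → (zdGF3HP₂Per 𝔸 L β len i P).InAAx α₀ U₀ Q →
        (zdGF3HP₂Per 𝔸 L β len i P).avgClose166 α₁ U₀ Q →
          ∃ u : (zdGF3HP₂Per 𝔸 L β len i P).GT, (zdGF3HP₂Per 𝔸 L β len i P).Restricted U₀ u ∧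
            ((zdGF3HP₂Per 𝔸 L β len i P).C137 α₁ U₀ ((zdGF3HP₂Per 𝔸 L β len i P).act Q u) ∧
              (zdGF3HP₂Per 𝔸 L β len i P).Landau U₀ ((zdGF3HP₂Per 𝔸 L β len i P).act Q u) ∧
              (zdGF3HP₂Per 𝔸 L β len i P).C162 B₁' (α₀ + α₁) U₀ ((zdGF3HP₂Per 𝔸 L β len i P).act Q u)) ∧
            ∀ u' : (zdGF3HP₂Per 𝔸 L β len i P).GT, (zdGF3HP₂Per 𝔸 L β len i P).Restricted U₀ u' →
              (zdGF3HP₂Per 𝔸 L β len i P).C137 α₁ U₀ ((zdGF3HP₂Per 𝔸 L β len i P).act Q u') →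
              (zdGF3HP₂Per 𝔸 L β len i P).Landau U₀ ((zdGF3HP₂Per 𝔸 L β len i P).act Q u') →
              (zdGF3HP₂Per 𝔸 L β len i P).C162 B₁' (α₀ + α₁) U₀ ((zdGF3HP₂Per 𝔸 L β len i P).act Q u') → u' = u) :
    Thm4TorusAt L i.k (P : ℤ) i.η c₁' (unitaryUnits 𝔸) Reg (Restr129 L i.k (torusLam i.k))
      (fun (α₀ α₁ : ℝ) (U₀ U' : Site d → Fin d → 𝔸ˣ) (u : Site d → 𝔸ˣ) =>
        ∃ A : Site d → Fin d → 𝔸,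
          (∀ x μ, IsSelfAdjoint (A x μ)) ∧ IsPeriodic P A ∧ mgauge U₀ u (cfgExp i.η A) = U' ∧
          (∀ x μ, ‖A x μ‖ ≤ B₁' * (α₀ + α₁) * ((L : ℝ) ^ i.k * i.η)⁻¹) ∧
          IsLandau138 L i.k i.η Set.univ (torusLam i.k) U₀ A ∧
          (∀ (y : Site d) (ν : Fin d), ‖logCovIter L U₀ (iEta i.η A) i.k y ν‖ < 2 * d * L * α₁)) := by
  intro α₀ α₁ hα₀ hα₁ hs U₀ U' hU₀G hU'G hU₀P hU'P hA₀ _ hA hAx h166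
  have hL1 : 1 ≤ L := le_trans (by norm_num) hL
  have hL1r : (1 : ℝ) ≤ L := by exact_mod_cast hL1
  have hη := i.hη
  -- periodicity of the data
  have hU₀per : IsPeriodic P U₀ := (isPeriodic_iff_shiftCfg U₀).2 hU₀P
  have hU'per : IsPeriodic P U' := (isPeriodic_iff_shiftCfg U').2 hU'P
  -- the member's sets on the levels Theorem 4 reads
  have hΩ0 : i.Ω 0 = Set.univ := hΩ 0 (Nat.zero_le _)
  have hΛk : ∀ l, l ≤ i.k → i.Λs i.k l = torusLam i.k l := hΛs i.k le_rfl
  have hTB : ∀ j, j ≤ i.k → ∀ c : Site d × Fin d, c ∈ towerBondsP L i.Ω (i.Λs i.k) j ↔ j = i.k :=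
    fun j hj c => mem_towerBondsP_iff_eq_top hΩ hΛk hj c
  have hst : ∀ j, j ≤ i.k → ∀ (y : Site d) (τ : Fin d), SideTouches (i.Ω j) y τ := fun j hj y τ => by
    rw [hΩ j hj]; exact sideTouches_univ hd2 y τ
  have hmlog : ∀ W : Site d → Fin d → 𝔸ˣ, mlogCfg i.k i.η i.Ω W = logCfg i.η W := mlogCfg_eq_logCfg_of_univ_zero hd2 i.k i.η hΩ0
  -- letters: `B₁′(α₀+α₁)L^{-k} ≤ 1/16`, and the Prop.-2 window at `α₀`
  have hs0 : 0 ≤ α₀ + α₁ := by linarith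
  have hLk : (1 : ℝ) ≤ (L : ℝ) ^ i.k := one_le_pow₀ hL1r
  have hC0' : C0 d * (2 * α₀) ≤ 1 / 3 :=
    (mul_le_mul_of_nonneg_left (by linarith) (C0_pos d).le).trans hC0
  have hunit : ∀ j ≤ i.k, ∀ (x : Site d) (κ : Fin d), avgIter L U₀ j x κ ∈ unitaryUnits 𝔸 :=
    avgIter_mem_unitaryUnits_of_inAk_univ hL hα₀ hC0' (by linarith) hU₀G hA₀
  -- the leaf's data at the member
  let U₀c : (zdGF3HP₂Per 𝔸 L β len i P).Cfg := ⟨U₀, hU₀G, hU₀per⟩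
  let Q : (zdGF3HP₂Per 𝔸 L β len i P).Pert := (U₀c, ⟨U', hU'G, hU'per⟩)
  have hInA : (zdGF3HP₂Per 𝔸 L β len i P).InA α₀ U₀c := by
    show InAk L i.k i.η α₀ i.Ω U₀
    exact (inAk_congr_le (Ω' := fun _ => Set.univ) hΩ U₀).2 hA₀
  have hInAAx : (zdGF3HP₂Per 𝔸 L β len i P).InAAx α₀ U₀c Q := by
    refine ⟨rfl, ?_, fun m hm => ?_⟩
    · show InAk L i.k i.η α₀ i.Ω (mulCfg U' U₀)
      exact (inAk_congr_le (Ω' := fun _ => Set.univ) hΩ _).2 hA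
    · show InAx L m (i.Λs m) U₀ (mulCfg U' U₀)
      exact (inAx_congr_le (hΛs m hm) U₀ _).2 (inAx_torusLam_of_le hL1 hm hAx)
  have h166' : (zdGF3HP₂Per 𝔸 L β len i P).avgClose166 α₁ U₀c Q := by
    refine ⟨fun j hj z μ _ => ?_, fun b _ => ?_⟩
    · show ‖(avgIter L (mulCfg U' U₀) j z μ : 𝔸) - (avgIter L U₀ j z μ : 𝔸)‖ ≤ α₁
      exact avgClose_of_cond166T h166 hunit j hj z μ
    · show ‖((U' b.1 b.2 : 𝔸ˣ) : 𝔸) - 1‖ ≤ α₁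
      exact sides_of_cond166T h166 b.1 b.2
  obtain ⟨u, h129, ⟨h137, hLan, h162⟩, huniq⟩ := hT α₀ α₁ hα₀ hα₁ (hs.trans hc) U₀c Q hInA trivial hInAAx h166'
  -- the gauge-fixed field `W = U′^{u⁻¹}` and its logarithm
  have huper : IsPeriodic P u.1 := u.2.2
  have hW : mgauge U₀ u.1 (mgauge U₀ u.1⁻¹ U') = U' := mgauge_mgauge_inv U₀ U' u.1
  have hWper : IsPeriodic P (mgauge U₀ u.1⁻¹ U') := isPeriodic_mgauge hU₀per (isPeriodic_inv huper) hU'per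
  have h162' : ∀ (y : Site d) (τ : Fin d), mgauge U₀ u.1⁻¹ U' y τ = cfgExp i.η (logCfg i.η (mgauge U₀ u.1⁻¹ U')) y τ ∧
      IsSelfAdjoint (logCfg i.η (mgauge U₀ u.1⁻¹ U') y τ) ∧
      ‖logCfg i.η (mgauge U₀ u.1⁻¹ U') y τ‖ ≤ B₁' * (α₀ + α₁) * ((L : ℝ) ^ i.k * i.η)⁻¹ :=
    fun y τ => h162 i.k le_rfl (y, τ) (hst i.k le_rfl y τ)
  have hWexp : mgauge U₀ u.1⁻¹ U' = cfgExp i.η (logCfg i.η (mgauge U₀ u.1⁻¹ U')) := by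
    funext y τ; exact (h162' y τ).1
  have hAper : IsPeriodic P (logCfg i.η (mgauge U₀ u.1⁻¹ U')) := fun x m => by
    funext τ
    simp only [logCfg, congrFun (hWper x m) τ]
  refine ⟨u.1, ⟨u.2.1.1, fun x j => huper x (e j), ?_, logCfg i.η (mgauge U₀ u.1⁻¹ U'),
    fun y τ => (h162' y τ).2.1, hAper, by rw [← hWexp]; exact hW, fun y τ => (h162' y τ).2.2, ?_, fun y ν => ?_⟩, ?_⟩
  · -- (1.29)
    have h := h129
    change Restr129 L i.k (i.Λs i.k) U₀ u.1 at h
    exact (restr129_congr_le hΛk U₀ u.1).1 h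
  · -- (1.38) (the domain is rewritten through a generalisation: `u`'s type mentions `i.Ω 0`)
    have key : ∀ S : Set (Site d), S = Set.univ → IsLandau138 L i.k i.η S (i.Λs i.k) U₀ (logCfg i.η (mgauge U₀ u.1⁻¹ U')) →
        IsLandau138 L i.k i.η Set.univ (torusLam i.k) U₀ (logCfg i.η (mgauge U₀ u.1⁻¹ U')) := by
      rintro S rfl h; exact (isLandau138_congr_le hΛk U₀ _).1 h
    exact key _ hΩ0 hLan
  · -- (1.37) at the level-`k` bonds
    have h := h137 i.k le_rfl (y, ν) ((hTB i.k le_rfl (y, ν)).2 rfl)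
    change ‖logCovIter L U₀ (iEta i.η (mlogCfg i.k i.η i.Ω (mgauge U₀ u.1⁻¹ U'))) i.k y ν‖ < 2 * d * L * α₁ at h
    rwa [hmlog] at h
  · -- uniqueness among ALL periodic unitary gauges with (1.29) and `Concl_T4`
    rintro u' hu'G hu'P hRes' ⟨A', hsa', -, hmg', hbd', hLan', h137'⟩
    have hu'per : IsPeriodic P u' :=
      (isPeriodic_iff_shiftCfg u').2 fun μ => funext fun x => by rw [shiftCfg_apply]; exact hu'P x μ
    let u'c : (zdGF3HP₂Per 𝔸 L β len i P).GT := ⟨u', ⟨hu'G, fun x hx => absurd (by rw [hΩ0]; exact Set.mem_univ x) hx⟩, hu'per⟩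
    -- the competitor's gauge-fixed field is `e^{iηA′}`, and `A′` is its logarithm
    have hW'eq : mgauge U₀ u'⁻¹ U' = cfgExp i.η A' := (eq_mgauge_inv_of_mgauge_eq hmg').symm
    have hW'u : ∀ x κ, cfgExp i.η A' x κ ∈ unitaryUnits 𝔸 := mem_unitaryUnits_of_mgauge_eq hU₀G hU'G hu'G hmg'
    have ht : B₁' * (α₀ + α₁) * ((L : ℝ) ^ i.k)⁻¹ ≤ 1 / 16 := by
      have hBs : B₁' * (α₀ + α₁) ≤ 1 / 16 := by nlinarith [mul_le_mul_of_nonneg_left hs hB]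
      have h1 : B₁' * (α₀ + α₁) * ((L : ℝ) ^ i.k)⁻¹ ≤ B₁' * (α₀ + α₁) * 1 :=
        mul_le_mul_of_nonneg_left (inv_le_one_of_one_le₀ hLk) (mul_nonneg hB hs0)
      linarith
    have hbdη : ∀ x κ, ‖A' x κ‖ ≤ B₁' * (α₀ + α₁) * ((L : ℝ) ^ i.k)⁻¹ * i.η⁻¹ := fun x κ => by
      have h := hbd' x κ
      rwa [mul_inv, ← mul_assoc] at h
    have hlog : logCfg i.η (mgauge U₀ u'⁻¹ U') = A' := by
      rw [hW'eq]
      funext x κ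
      exact (logField_spec hη U₀ hW'u (rfl : cfgExp i.η A' x κ = cfgExp i.η A' x κ) (hbdη x κ) ht).1
    have hR' : (zdGF3HP₂Per 𝔸 L β len i P).Restricted U₀c u'c := by
      show Restr129 L i.k (i.Λs i.k) U₀ u'
      exact (restr129_congr_le hΛk U₀ u').2 hRes'
    have h137'' : (zdGF3HP₂Per 𝔸 L β len i P).C137 α₁ U₀c ((zdGF3HP₂Per 𝔸 L β len i P).act Q u'c) := by
      show ∀ j, j ≤ i.k → ∀ c ∈ towerBondsP L i.Ω (i.Λs i.k) j,
        ‖logCovIter L U₀ (iEta i.η (mlogCfg i.k i.η i.Ω (mgauge U₀ u'⁻¹ U'))) j c.1 c.2‖ < 2 * d * L * α₁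
      intro j hj c hc
      obtain rfl := (hTB j hj c).1 hc
      rw [hmlog, hlog]
      exact h137' c.1 c.2
    have hLan'' : (zdGF3HP₂Per 𝔸 L β len i P).Landau U₀c ((zdGF3HP₂Per 𝔸 L β len i P).act Q u'c) := by
      show IsLandau138 L i.k i.η (i.Ω 0) (i.Λs i.k) U₀ (logCfg i.η (mgauge U₀ u'⁻¹ U'))
      rw [hlog, hΩ0]
      exact (isLandau138_congr_le hΛk U₀ A').2 hLan'
    have h162'' : (zdGF3HP₂Per 𝔸 L β len i P).C162 B₁' (α₀ + α₁) U₀c ((zdGF3HP₂Per 𝔸 L β len i P).act Q u'c) := by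
      show ∀ j, j ≤ i.k → ∀ b ∈ {b : Site d × Fin d | SideTouches (i.Ω j) b.1 b.2},
        mgauge U₀ u'⁻¹ U' b.1 b.2 = cfgExp i.η (logCfg i.η (mgauge U₀ u'⁻¹ U')) b.1 b.2 ∧
          IsSelfAdjoint (logCfg i.η (mgauge U₀ u'⁻¹ U') b.1 b.2) ∧
          ‖logCfg i.η (mgauge U₀ u'⁻¹ U') b.1 b.2‖ ≤ B₁' * (α₀ + α₁) * ((L : ℝ) ^ j * i.η)⁻¹
      intro j hj b _
      rw [hlog, hW'eq]
      refine ⟨rfl, hsa' b.1 b.2, (hbd' b.1 b.2).trans ?_⟩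
      have hLj : (L : ℝ) ^ j * i.η ≤ (L : ℝ) ^ i.k * i.η :=
        mul_le_mul_of_nonneg_right (pow_le_pow_right₀ hL1r hj) hη.le
      have hLj0 : 0 < (L : ℝ) ^ j * i.η := by positivity
      exact mul_le_mul_of_nonneg_left (inv_anti₀ hLj0 hLj) (mul_nonneg hB hs0)
    have heq := huniq u'c hR' h137'' hLan'' h162''
    exact congrArg Subtype.val heq

end Member

/-! ## §3 From `B8.Thm4Printed` on the periodic δ₂-family (the `t4` conjunct of node N05's κ-slot), at an all-torus index -/

section Family

variable {𝔸 : Type} [CStarAlgebra 𝔸] [Nontrivial 𝔸]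

/-- **★★ N16's TORUS READING OF THEOREM 4 FROM THE PRINTED THEOREM ON NODE N05's PERIODIC δ₂-FAMILY** — for `d, L ≥ 2`, any index map `ι` and period map `p`, and any index `a`
whose member is all-torus on everything Theorem 4 reads (`Ω_j = ℤᵈ (j ≤ k)`, `Λs m l = torusLam m l (l ≤ m ≤ k)`):
`B8.Thm4Printed B₁′ (fun a ↦ (zdGF3HP₂Per 𝔸 L β len (ι a) (p a)).toGFData)` (the `t4` conjunct of `Node00.B8LeafOfRecordSubBP₂DPerκ`, projected by
`Node00.b8LeafOfRecordSubBP₂DPerκ_t4`, reads exactly this with `ι := (·).toZdIdx`, `p := fun _ ↦ P`) and `0 ≤ B₁′` give `∃ c₁′ > 0` with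
`Thm4TorusAt L k (p a) η c₁′ (unitaryUnits 𝔸) Reg (Restr129 L k (torusLam k)) Concl_T4` for every `Reg` (§2 in the window of n16-c's `exists_window`).
[cite: Balaban1985RegularSpaces, Thm 4 p.88 («There exists a constant c₁ … exactly one gauge transformation u»), p.77 («we admit the case where some domains Ω_j are equal to T_η»)] -/
theorem exists_thm4TorusAt_of_thm4Printed_hp2per (hd2 : 2 ≤ d) {L : ℕ} (hL : 2 ≤ L) {β : ℝ} {len : Site d → ℝ} {J : Type} (ι : J → ZdIdx d L) (p : J → ℕ)
    {B₁' : ℝ} (hB : 0 ≤ B₁') (h : B8.Thm4Printed B₁' (fun a : J => (zdGF3HP₂Per 𝔸 L β len (ι a) (p a)).toGFData)) (a : J)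
    (hΩ : ∀ j, j ≤ (ι a).k → (ι a).Ω j = Set.univ) (hΛs : ∀ m, m ≤ (ι a).k → ∀ l, l ≤ m → (ι a).Λs m l = torusLam m l)
    (Reg : (Site d → Fin d → 𝔸ˣ) → Prop) :
    ∃ c₁' : ℝ, 0 < c₁' ∧ Thm4TorusAt L (ι a).k (p a : ℤ) (ι a).η c₁' (unitaryUnits 𝔸) Reg (Restr129 L (ι a).k (torusLam (ι a).k))
      (fun (α₀ α₁ : ℝ) (U₀ U' : Site d → Fin d → 𝔸ˣ) (u : Site d → 𝔸ˣ) =>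
        ∃ A : Site d → Fin d → 𝔸,
          (∀ x μ, IsSelfAdjoint (A x μ)) ∧ IsPeriodic (p a) A ∧ mgauge U₀ u (cfgExp (ι a).η A) = U' ∧
          (∀ x μ, ‖A x μ‖ ≤ B₁' * (α₀ + α₁) * ((L : ℝ) ^ (ι a).k * (ι a).η)⁻¹) ∧
          IsLandau138 L (ι a).k (ι a).η Set.univ (torusLam (ι a).k) U₀ A ∧
          (∀ (y : Site d) (ν : Fin d), ‖logCovIter L U₀ (iEta (ι a).η A) (ι a).k y ν‖ < 2 * d * L * α₁)) := by
  obtain ⟨c₁, hc₁, H⟩ := h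
  obtain ⟨c₁', hc₁', hc, h16, hC0, hc2⟩ := exists_window (d := d) (le_trans (by norm_num) hL) hc₁ hB
  exact ⟨c₁', hc₁', thm4TorusAt_of_hp2per_member hd2 hL (ι a) (p a) hΩ hΛs hc hB h16 hC0 hc2 Reg (H a)⟩

end Family

/-! ## §4 At node N05's witness slot of record: the κ-periodic δ₂-slot read at the all-torus member of its cut -/

section Slot

open Node00 (Stage3Params IdxB8SubDPerκ ResidB8Per B8LeafOfRecordSubBP₂DPerκ b8LeafOfRecordSubBP₂DPerκ_t4)
open B8Eq134Admissible (univFam)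
open B8IdxB8SubDPerUnivFam (exists_idxB8SubDPerκ_univFam univFam_of_le)

/-- **★★★ NODE N16's TORUS READING OF [B8] THEOREM 4 FROM NODE N05's WITNESS SLOT OF RECORD.**  For Stage-3 parameters `θ` with `θ.D ≥ 2`, any period `P`, pins `(M₁, R)` and
residual layer `lam : ResidB8Per θ P` with `0 ≤ lam.base.B₁′`: the κ-periodic δ₂-slot `Node00.B8LeafOfRecordSubBP₂DPerκ θ P M₁ R lam` (node N05's DISPLAY over the print-class
periodic cut; its `t4` conjunct = Theorem 4 AS PRINTED on `famB8OfRecordSubBP₂DPer θ β len P ∘ val = zdGF3HP₂Per θ.𝔸 θ.L β len (·.toZdIdx) P`, `rfl`) gives, at EVERY depth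
`k ≥ 1` with `Lᵏ ∣ P` (`0 < P`), a threshold `c₁′ > 0` and
`Thm4TorusAt θ.L k P L⁻ᵏ c₁′ (unitaryUnits θ.𝔸) Reg (Restr129 θ.L k (torusLam k)) Concl_T4` for every `Reg` — §3 at the truncated all-torus member `univFam k` of the κ-cut
(`exists_idxB8SubDPerκ_univFam`, for EVERY `(M₁, R)`), whose towers are diagonal on `l ≤ m ≤ k` by rigidity (`IdxB8SubDPerκ.Λs_univFam`).  The bound `‖A‖ ≤ B₁′(α₀+α₁)(Lᵏ·L⁻ᵏ)⁻¹`
is §3's letter verbatim (`= B₁′(α₀+α₁)`).  The slot is a HYPOTHESIS (node N05's theorem inhabits it); nothing of it is proved here.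
[cite: Balaban1985RegularSpaces, Thm 4 p.88, (1.3)–(1.5) p.77 («we admit the case where some domains Ω_j are equal to T_η»), (1.68) p.88; Balaban1987RG1, (0.1) p.251] -/
theorem exists_thm4TorusAt_of_b8LeafOfRecordSubBP₂DPerκ {θ : Stage3Params} (hD : 2 ≤ θ.D) {P M₁ R : ℕ} (lam : ResidB8Per θ P)
    (h : B8LeafOfRecordSubBP₂DPerκ θ P M₁ R lam) (hB : 0 ≤ lam.base.B₁') {k : ℕ} (hk : 1 ≤ k) (hP : 0 < P) (hdvd : θ.L ^ k ∣ P)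
    (Reg : (Site θ.D → Fin θ.D → θ.𝔸ˣ) → Prop) :
    ∃ c₁' : ℝ, 0 < c₁' ∧ Thm4TorusAt θ.L k (P : ℤ) (((θ.L : ℝ) ^ k)⁻¹) c₁' (unitaryUnits θ.𝔸) Reg (Restr129 θ.L k (torusLam k))
      (fun (α₀ α₁ : ℝ) (U₀ U' : Site θ.D → Fin θ.D → θ.𝔸ˣ) (u : Site θ.D → θ.𝔸ˣ) =>
        ∃ A : Site θ.D → Fin θ.D → θ.𝔸,
          (∀ x μ, IsSelfAdjoint (A x μ)) ∧ IsPeriodic P A ∧ mgauge U₀ u (cfgExp (((θ.L : ℝ) ^ k)⁻¹) A) = U' ∧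
          (∀ x μ, ‖A x μ‖ ≤ lam.base.B₁' * (α₀ + α₁) * ((θ.L : ℝ) ^ k * ((θ.L : ℝ) ^ k)⁻¹)⁻¹) ∧
          IsLandau138 θ.L k (((θ.L : ℝ) ^ k)⁻¹) Set.univ (torusLam k) U₀ A ∧
          (∀ (y : Site θ.D) (ν : Fin θ.D), ‖logCovIter θ.L U₀ (iEta (((θ.L : ℝ) ^ k)⁻¹) A) k y ν‖ < 2 * θ.D * θ.L * α₁)) := by
  obtain ⟨j, hη, hjk, hΩ⟩ := exists_idxB8SubDPerκ_univFam θ M₁ R hk hP hdvd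
  -- the slot's `t4` conjunct, on the periodic δ₂-model at the cut members (`famB8OfRecordSubBP₂DPer_kappa_eq`, `rfl`)
  have h4 : B8.Thm4Printed lam.base.B₁'
      (fun a : IdxB8SubDPerκ θ P M₁ R => (zdGF3HP₂Per θ.𝔸 θ.L lam.base.β lam.base.len a.toZdIdx P).toGFData) :=
    b8LeafOfRecordSubBP₂DPerκ_t4 lam h
  -- the member's sets on the levels Theorem 4 reads
  have hΩ' : ∀ l, l ≤ j.toZdIdx.k → j.toZdIdx.Ω l = Set.univ := fun l hl => by
    rw [hΩ]; exact univFam_of_le (by rw [hjk] at hl; exact hl)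
  have hΛs' : ∀ m, m ≤ j.toZdIdx.k → ∀ l, l ≤ m → j.toZdIdx.Λs m l = torusLam m l := fun m hm l hl => by
    rw [B8IdxB8SubDPerUnivFam.IdxB8SubDPerκ.Λs_univFam j hΩ hjk (by rw [hjk] at hm; exact hm) hl]
    rfl
  obtain ⟨c₁', hc₁', hT⟩ := exists_thm4TorusAt_of_thm4Printed_hp2per hD θ.two_le_L (fun a : IdxB8SubDPerκ θ P M₁ R => a.toZdIdx)
    (fun _ => P) hB h4 j hΩ' hΛs' Reg
  refine ⟨c₁', hc₁', ?_⟩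
  rw [← hη, ← hjk]
  exact hT

end Slot

end

end Summit.QuantumFields.YangMills.BalabanUVNodes.N16.Thm4TorusOfHP2PerMember
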